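import Summits.QuantumFields.YangMills.Theorems.BalabanUVNodesN15KingModelFullPropagatorMixedOperator

/-!
# BalabanUVNodes ∕ N15 — THE KING-MODEL RUNG, CURVED EDITION (PART V-c): [B9] (3.44) AT `U ≡ 1` WITH THE PRINTED SUPPORT CONDITION — sources of
# ARBITRARY support (e.g. the big cube `Δ̃(y′)`), decay from the block distance `D = dist(B(x), supp λ)`:
# `|(∇_μ′A₀⁻¹∇*_μλ)(x)| ≤ C(ε)·H·e^{−δD}`, UNIFORMLY in `K`, the volume and the mass
# (Track A, DAG node N15 = NE2; FAN-OUT v1.1 §N15 s3 «KING-MODEL RUNG … + the one-line statement of what the curved case adds»)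

HONEST FRAMING.  Count-neutral kernel bookkeeping (cell `pub-ymgap`, seat `pub-ymgap-dag-n15-e` g9; `--supports stmt-QuantumFields-20544
--as helper` = K3⁷ `SpineGivenEndpointR13SepCoPH`, WORDS-143).  TEMPLATE LITERATURE, `A = 0`: C. King's scalar U(1)-Higgs MODEL on finite tori ([King1986]
(2.13) p. 653, Prop. 3.7 (3.63) p. 663), NOT Bałaban's covariant objects.  [Balaban1985BackgroundPropagators] Thm 3.1 (3.44) p. 398 prints
«`|(∇_UG∇*_Uλ)(x)| ≤ B′₀(ε)exp(−δ₀d(y, y′))(ξ′^ε‖λ‖_ε + |λ|)` for `0 < ε ≤ 1`, `x ∈ Δ(y)`, `supp λ ⊂ Δ̃(y′)`» — the support is the BIG cube `Δ̃(y′)`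
(several unit blocks), not one block.  Part V-b (`fullPropMixedOp_holder_le`) took ONE-block sources; THIS FILE removes that restriction: the support is
arbitrary and the decay is measured by any `D` with `D ≤ |B(x) − B(y)|_M` on `supp λ` (for `supp λ ⊂ Δ̃(y′)` and `x ∈ Δ(y)`, `D = d(y, y′) − O(1)`).
Decided in the MODEL at `U ≡ 1`; NOT the printed proposition (covariant `G(U)` over `Reg335`, multiscale carrier); NE2⁺ is NOT PRINTED and not proved
here; NOT a node discharge; nothing continuum ∕ ℝ⁴ ∕ OS ∕ mass-gap ∕ Clay.  0 `sorry`, 0 `def`, standard axioms.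

THE PROOF is part V-b's verbatim (kernel sum `inv_deriv_adjDeriv_eq_sum`, cancellation `sum_mixedKernel_eq_zero`, part V-a profile with block decay,
`levelShell_sum_le`, geometric series in `L^{−ε}`); only the decay bookkeeping changes: for a term with `λ(y) ≠ λ(x)` either `λ(y) ≠ 0` (then
`D ≤ |B(x) − B(y)|` by hypothesis) or `λ(x) ≠ 0` (then `D ≤ |B(x) − B(x)| = 0`), so `e^{−δ₀|B(y) − B(x)|} ≤ e^{−δ₀D}` in both cases.
* ★★ `fullPropMixedOp_holder_le_of_suppDist` — `0 < ε ≤ 1`: `∃ C δ > 0 ∀ K ≥ 1 ∀ N = L^K ∀ cube 2L^e ∀ 0 < m² ≤ m₀² ∀ μ μ′ ∀ λ, H ≥ 0` with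
  `|λ(y) − λ(y′)| ≤ H(|y − y′|∕N)^ε`, `∀ x D`, (`λ(y) ≠ 0 ⇒ D ≤ |B(x) − B(y)|_M`) ⇒ `|N((A₀⁻¹∇*_μλ)(x+e_μ′) − (A₀⁻¹∇*_μλ)(x))| ≤ C·H·e^{−δD}`.
WHAT THE CURVED CASE ADDS (one line): (3.44) itself for `∇_UG(U)∇*_U` uniformly over `Reg335`, multiscale sites, analyticity in `U`.
HONEST SCOPE.  As part V-b: (i) `A = 0`, periodic b.c., odd `L ≥ 3`, cubes `2L^e`, `K ≥ 1`, `0 < m² ≤ m₀²`; (ii) King's spelling of `A₀`, forward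
η-differences, sup torus distance; (iii) GLOBAL Hölder modulus in unit coordinates of level `K` (no separate `|λ|` term); (iv) `0 < ε ≤ 1`; (v) not
Bałaban's `G(U)`; not a discharge.
Locators: [Balaban1985BackgroundPropagators] Thm 3.1 (3.44) p. 398; [King1986] (2.13) p. 653, Prop. 3.7 (3.63) p. 663, (4.42)–(4.44) p. 675;
[Balaban1983RegularityDecay] Theorem (1.10) p. 573, §5 (5.7)–(5.8) p. 594.
-/

noncomputable section

namespace Summit.QuantumFields.YangMills.BalabanUVNodes.N15KingModelRung.Curved

open Real Finset Matrix
open Literature.MathematicalPhysics.QuantumFieldTheory.Balaban1983to89 (Params)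
open Literature.MathematicalPhysics.QuantumFieldTheory.Balaban1983to89.B4Sect5Proof (latticeConst)
open Literature.MathematicalPhysics.QuantumFieldTheory.Balaban1983to89.B5Prop11Plancherel (Tor fine unitVec)
open Literature.MathematicalPhysics.QuantumFieldTheory.King1986 (aK aK_pos)
open Literature.MathematicalPhysics.QuantumFieldTheory.King1986.Torus (fineOp constrainedProp blockOf tdistT tdistT_nonneg tdistT_symm
  tdistT_self tdistT_sumBound)

variable {d : ℕ} (L : ℕ) [NeZero L]

/-- **[B9] (3.44) AT `U ≡ 1`, ARBITRARY SUPPORT — KING'S FULL `A = 0` FLUCTUATION PROPAGATOR.**  For odd `L ≥ 3`, `a > 0`, a mass cap `m₀² ≥ 0` and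
`0 < ε ≤ 1` there are `C, δ > 0` (functions of `d, L, a, m₀², ε`) such that for EVERY `K ≥ 1` (spelling `N = L^K`), cube `M_μ = 2L^e`, mass
`0 < m² ≤ m₀²`, directions `μ, μ′`, every source `λ` on the fine torus, ε-HÖLDER in unit coordinates (`|λ(y) − λ(y′)| ≤ H·(|y − y′|∕N)^ε`, `H ≥ 0`),
every fine point `x` and every `D` with `D ≤ |B(x) − B(y)|_M` whenever `λ(y) ≠ 0`:
`|N·((A₀⁻¹∇*_μλ)(x + e_μ′) − (A₀⁻¹∇*_μλ)(x))| ≤ C·H·exp(−δD)` — the printed shape with `supp λ ⊂ Δ̃(y′)` arbitrary and the decay from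
`dist(B(x), supp λ)`, uniformly in `K`, the volume and the mass (part V-b = the one-block case).
[cite: Balaban1985BackgroundPropagators, Thm 3.1 (3.44) p.398; King1986, (2.13) p.653, Prop. 3.7 (3.63) p.663; Balaban1983RegularityDecay, Theorem (1.10) p.573] -/
theorem fullPropMixedOp_holder_le_of_suppDist (hLodd : Odd L) (hL : 2 ≤ L) {a : ℝ} (ha : 0 < a) {m0sq : ℝ} (hm0 : 0 ≤ m0sq)
    {ε : ℝ} (hε0 : 0 < ε) (hε1 : ε ≤ 1) :
    ∃ C δ : ℝ, 0 < C ∧ 0 < δ ∧ ∀ (K : ℕ), 1 ≤ K → ∀ (N : ℕ) [NeZero N], N = L ^ K →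
      ∀ (e : ℕ) (M : Fin (d + 1) → ℕ) [∀ μ, NeZero (M μ)], (∀ μ, M μ = 2 * L ^ e) →
      ∀ (msq : ℝ), 0 < msq → msq ≤ m0sq → ∀ (μ μ' : Fin (d + 1)) (lam : Tor (fine N M) → ℝ) (H : ℝ),
        0 ≤ H →
        (∀ y y', |lam y - lam y'| ≤ H * (tdistT (fine N M) y y' / (N : ℝ)) ^ ε) →
        ∀ (x : Tor (fine N M)) (D : ℝ), (∀ y, lam y ≠ 0 → D ≤ tdistT M (blockOf N M x) (blockOf N M y)) →
        |(N : ℝ) * (((fineOp N M (aK a L K) (((N : ℕ) : ℝ) ^ 2) msq)⁻¹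
                *ᵥ (fun y => (N : ℝ) * (lam (y - unitVec (fine N M) μ) - lam y))) (x + unitVec (fine N M) μ')
            - ((fineOp N M (aK a L K) (((N : ℕ) : ℝ) ^ 2) msq)⁻¹
                *ᵥ (fun y => (N : ℝ) * (lam (y - unitVec (fine N M) μ) - lam y))) x)|
          ≤ C * H * Real.exp (-(δ * D)) := by
  have hL1 : 1 < L := by omega
  have hLr : (1 : ℝ) < L := by exact_mod_cast hL1
  have hL0 : (0 : ℝ) < L := by linarith
  obtain ⟨C₀, δ₀, hC₀, hδ₀, HDD⟩ := fullPropDD_profile_decay_unif (d := d) L hLodd hL ha hm0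
  -- the rate used inside the levels (`≤ 1` for the small-rate lattice sum) and the level factor `θ = L^{−ε} < 1`
  set δ₁ : ℝ := min δ₀ 1 with hδ₁def
  have hδ₁0 : 0 < δ₁ := lt_min hδ₀ one_pos
  have hδ₁δ : δ₁ ≤ δ₀ := min_le_left _ _
  have hδ₁1 : δ₁ ≤ 1 := min_le_right _ _
  set θ : ℝ := (L : ℝ) ^ (-ε) with hθdef
  have hθ0 : 0 ≤ θ := Real.rpow_nonneg hL0.le _
  have hθ1 : θ < 1 := Real.rpow_lt_one_of_one_lt_of_neg hLr (by linarith)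
  have h1θ : 0 < 1 - θ := sub_pos.mpr hθ1
  set A₁ : ℝ := 2 * δ₁ ^ (-ε) * (8 * ((d : ℝ) + 1) / δ₁) ^ (d + 1) with hA₁def
  have hA₁ : 0 < A₁ := by positivity
  refine ⟨C₀ * A₁ / (1 - θ), δ₀, div_pos (mul_pos hC₀ hA₁) h1θ, hδ₀, ?_⟩
  intro K hK N _ hN e M _ hM msq hmsq hcap μ μ' lam H hH0 hH x D hsupp
  have hN1 : (1 : ℝ) ≤ (N : ℝ) := by rw [hN]; exact_mod_cast Nat.one_le_pow K L (by omega)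
  have hN0 : 0 < (N : ℝ) := by linarith
  have hNK : ((N : ℝ)) = (L : ℝ) ^ K := by rw [hN, Nat.cast_pow]
  set D₀ : ℝ := D with hD₀def
  -- Step A: the kernel sum, the kernel as a named function, the cancellation
  rw [inv_deriv_adjDeriv_eq_sum]
  obtain ⟨DDk, hDDk⟩ : ∃ f : Tor (fine N M) → ℝ, ∀ y, f y
      = (N : ℝ) * ((N : ℝ) * (constrainedProp N M (aK a L K) (((N : ℕ) : ℝ) ^ 2) msq (y + unitVec (fine N M) μ) (x + unitVec (fine N M) μ')
            - constrainedProp N M (aK a L K) (((N : ℕ) : ℝ) ^ 2) msq y (x + unitVec (fine N M) μ'))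
          - (N : ℝ) * (constrainedProp N M (aK a L K) (((N : ℕ) : ℝ) ^ 2) msq (y + unitVec (fine N M) μ) x
            - constrainedProp N M (aK a L K) (((N : ℕ) : ℝ) ^ 2) msq y x)) := ⟨_, fun _ => rfl⟩
  rw [Finset.sum_congr rfl fun y _ => by rw [← hDDk y]]
  set c : ℝ := ((N : ℝ) ^ (d + 1))⁻¹ with hcdef
  have hc0 : 0 < c := by positivity
  have hcN : c * (N : ℝ) ^ (d + 1) = 1 := by rw [hcdef, inv_mul_cancel₀ (pow_ne_zero _ hN0.ne')]
  have hsum0 : ∑ y, DDk y = 0 := by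
    rw [Finset.sum_congr rfl fun y _ => hDDk y]
    exact sum_mixedKernel_eq_zero N M (aK a L K) (((N : ℕ) : ℝ) ^ 2) msq x μ μ'
  have hrepr : ∑ y, c * DDk y * lam y = ∑ y, c * DDk y * (lam y - lam x) := by
    have hx : ∑ y, c * DDk y * lam x = 0 := by
      rw [← Finset.sum_mul, ← Finset.mul_sum, hsum0, mul_zero, zero_mul]
    calc ∑ y, c * DDk y * lam y = ∑ y, (c * DDk y * (lam y - lam x) + c * DDk y * lam x) :=
          Finset.sum_congr rfl fun y _ => by ring
      _ = ∑ y, c * DDk y * (lam y - lam x) + ∑ y, c * DDk y * lam x := Finset.sum_add_distrib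
      _ = ∑ y, c * DDk y * (lam y - lam x) := by rw [hx, add_zero]
  rw [hrepr]
  -- the level sums at the rate `δ₁`, as a named function of the source point
  obtain ⟨S₁, hS₁⟩ : ∃ f : Tor (fine N M) → ℝ, ∀ y, f y = ∑ i ∈ Finset.range K, ((L : ℝ) ^ (d + 1) / (L : ℝ) ^ 2 * L * L) ^ i
      * Real.exp (-(δ₁ * (tdistT (fine N M) x y * (L : ℝ) ^ i / (N : ℝ)))) := ⟨_, fun _ => rfl⟩
  have hS₁0 : ∀ y, 0 ≤ S₁ y := fun y => by rw [hS₁]; exact Finset.sum_nonneg fun i _ => by positivity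
  -- Step B: termwise bound `|c·DD(y,x)·(λ(y) − λ(x))| ≤ c·C₀·H·e^{−δ₀D₀}·((|x−y|∕N)^ε·S₁(y))`
  have hterm : ∀ y, |c * DDk y * (lam y - lam x)|
      ≤ c * C₀ * H * Real.exp (-(δ₀ * D₀)) * ((tdistT (fine N M) x y / (N : ℝ)) ^ ε * S₁ y) := by
    intro y
    have hw0 : 0 ≤ (tdistT (fine N M) x y / (N : ℝ)) ^ ε := Real.rpow_nonneg (div_nonneg (tdistT_nonneg _ _ _) hN0.le) _
    by_cases hyx : lam y = lam x
    · rw [hyx, sub_self, mul_zero, abs_zero]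
      have := hS₁0 y
      positivity
    -- the profile with decay at `(y, x)` (part V-a)
    have hdd : |DDk y| ≤ C₀ * (∑ i ∈ Finset.range K, ((L : ℝ) ^ (d + 1) / (L : ℝ) ^ 2 * L * L) ^ i
          * Real.exp (-(δ₀ * (tdistT (fine N M) y x * (L : ℝ) ^ i / (N : ℝ)))))
        * Real.exp (-(δ₀ * tdistT M (blockOf N M y) (blockOf N M x))) := by
      rw [hDDk]
      exact HDD K hK N hN e M hM msq hmsq hcap μ μ' y x
    -- the block decay read at distance `D` from `B(x)`: either `λ(y) ≠ 0` (so `D ≤ |B(x) − B(y)|`) or `λ(x) ≠ 0` (so `D ≤ 0`)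
    have hdec : Real.exp (-(δ₀ * tdistT M (blockOf N M y) (blockOf N M x))) ≤ Real.exp (-(δ₀ * D₀)) := by
      apply Real.exp_le_exp.mpr
      by_cases hy0 : lam y = 0
      · have hx0 : lam x ≠ 0 := fun h => hyx (by rw [hy0, h])
        have hDx : D ≤ 0 := by have h := hsupp x hx0; rwa [tdistT_self] at h
        have := tdistT_nonneg M (blockOf N M y) (blockOf N M x)
        rw [hD₀def]
        nlinarith
      · have hDy := hsupp y hy0
        rw [tdistT_symm] at hDy
        rw [hD₀def]
        nlinarith
    -- the level exponentials at the rate `δ₁ ≤ δ₀`, the distance symmetrised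
    have hprof : ∑ i ∈ Finset.range K, ((L : ℝ) ^ (d + 1) / (L : ℝ) ^ 2 * L * L) ^ i
          * Real.exp (-(δ₀ * (tdistT (fine N M) y x * (L : ℝ) ^ i / (N : ℝ)))) ≤ S₁ y := by
      rw [hS₁]
      refine Finset.sum_le_sum fun i _ => mul_le_mul_of_nonneg_left ?_ (by positivity)
      rw [tdistT_symm]
      apply Real.exp_le_exp.mpr
      have h0 : 0 ≤ tdistT (fine N M) x y * (L : ℝ) ^ i / (N : ℝ) := by
        have := tdistT_nonneg (fine N M) x y; positivity
      nlinarith [mul_le_mul_of_nonneg_right hδ₁δ h0]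
    have hHy : |lam y - lam x| ≤ H * (tdistT (fine N M) x y / (N : ℝ)) ^ ε := by
      have h := hH y x
      rwa [tdistT_symm] at h
    have hDD' : |DDk y| ≤ C₀ * S₁ y * Real.exp (-(δ₀ * D₀)) :=
      hdd.trans (mul_le_mul (mul_le_mul_of_nonneg_left hprof hC₀.le) hdec (Real.exp_pos _).le
        (mul_nonneg hC₀.le (hS₁0 y)))
    calc |c * DDk y * (lam y - lam x)| = c * |DDk y| * |lam y - lam x| := by
          rw [abs_mul, abs_mul, abs_of_pos hc0]
      _ ≤ c * (C₀ * S₁ y * Real.exp (-(δ₀ * D₀))) * (H * (tdistT (fine N M) x y / (N : ℝ)) ^ ε) :=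
          mul_le_mul (mul_le_mul_of_nonneg_left hDD' hc0.le) hHy (abs_nonneg _) (by have := hS₁0 y; positivity)
      _ = c * C₀ * H * Real.exp (-(δ₀ * D₀)) * ((tdistT (fine N M) x y / (N : ℝ)) ^ ε * S₁ y) := by ring
  -- Step C: the levels — `Σ_y (|x−y|∕N)^ε·S₁(y) ≤ A₁·N^{d+1}·Σ_i θ^i ≤ A₁·N^{d+1}∕(1 − θ)`
  have hlevel : ∀ i ∈ Finset.range K, ((L : ℝ) ^ (d + 1) / (L : ℝ) ^ 2 * L * L) ^ i
      * ∑ y, (tdistT (fine N M) x y / (N : ℝ)) ^ ε * Real.exp (-(δ₁ * (tdistT (fine N M) x y * (L : ℝ) ^ i / (N : ℝ))))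
        ≤ A₁ * (N : ℝ) ^ (d + 1) * θ ^ i := by
    intro i hi
    have hiK : i < K := Finset.mem_range.mp hi
    have hq1 : (1 : ℝ) ≤ (L : ℝ) ^ i := one_le_pow₀ hLr.le
    have hq0 : (0 : ℝ) < (L : ℝ) ^ i := by linarith
    have hqN : (L : ℝ) ^ i ≤ (N : ℝ) := by rw [hNK]; exact pow_le_pow_right₀ hLr.le hiK.le
    have hS := levelShell_sum_le N M (q := (L : ℝ) ^ i) hq1 hqN hδ₁0 hδ₁1 hε0.le hε1 x
    have hΛ : ((L : ℝ) ^ (d + 1) / (L : ℝ) ^ 2 * L * L) ^ i = ((L : ℝ) ^ i) ^ (d + 1) := by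
      rw [LamL2_eq_pow L hL, ← pow_mul, ← pow_mul, Nat.mul_comm]
    -- `(L^i)^{−ε} = θ^i`
    have hθq : ((L : ℝ) ^ i) ^ (-ε) = θ ^ i := by
      rw [hθdef, ← Real.rpow_natCast (L : ℝ) i, ← Real.rpow_mul hL0.le, show ((i : ℕ) : ℝ) * -ε = -ε * (i : ℕ) by ring,
        Real.rpow_mul hL0.le, Real.rpow_natCast]
    -- `q^{d+1}·[2δ₁^{−ε}q^{−ε}(8(d+1)N∕(δ₁q))^{d+1}] = A₁·N^{d+1}·θ^i`
    have h8 : 8 * ((d : ℝ) + 1) * (N : ℝ) / (δ₁ * (L : ℝ) ^ i) = (8 * ((d : ℝ) + 1) / δ₁) * ((N : ℝ) / (L : ℝ) ^ i) :=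
      (div_mul_div_comm _ _ _ _).symm
    have halg : ((L : ℝ) ^ i) ^ (d + 1) * (2 * δ₁ ^ (-ε) * ((L : ℝ) ^ i) ^ (-ε)
          * (8 * ((d : ℝ) + 1) * (N : ℝ) / (δ₁ * (L : ℝ) ^ i)) ^ (d + 1))
        = A₁ * (N : ℝ) ^ (d + 1) * θ ^ i := by
      have hqd : ((L : ℝ) ^ i) ^ (d + 1) ≠ 0 := pow_ne_zero _ hq0.ne'
      have hδd : δ₁ ^ (d + 1) ≠ 0 := pow_ne_zero _ hδ₁0.ne'
      rw [hθq, h8, mul_pow, div_pow, div_pow, hA₁def, div_pow]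
      field_simp
    rw [hΛ]
    calc ((L : ℝ) ^ i) ^ (d + 1) * ∑ y, (tdistT (fine N M) x y / (N : ℝ)) ^ ε
            * Real.exp (-(δ₁ * (tdistT (fine N M) x y * (L : ℝ) ^ i / (N : ℝ))))
        ≤ ((L : ℝ) ^ i) ^ (d + 1) * (2 * δ₁ ^ (-ε) * ((L : ℝ) ^ i) ^ (-ε)
            * (8 * ((d : ℝ) + 1) * (N : ℝ) / (δ₁ * (L : ℝ) ^ i)) ^ (d + 1)) :=
          mul_le_mul_of_nonneg_left hS (by positivity)
      _ = A₁ * (N : ℝ) ^ (d + 1) * θ ^ i := halg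
  have hΦsum : ∑ y, (tdistT (fine N M) x y / (N : ℝ)) ^ ε * S₁ y ≤ A₁ * (N : ℝ) ^ (d + 1) * (1 / (1 - θ)) := by
    have hexpand : ∀ y, (tdistT (fine N M) x y / (N : ℝ)) ^ ε * S₁ y
        = ∑ i ∈ Finset.range K, ((L : ℝ) ^ (d + 1) / (L : ℝ) ^ 2 * L * L) ^ i
          * ((tdistT (fine N M) x y / (N : ℝ)) ^ ε * Real.exp (-(δ₁ * (tdistT (fine N M) x y * (L : ℝ) ^ i / (N : ℝ))))) := by
      intro y
      rw [hS₁, Finset.mul_sum]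
      exact Finset.sum_congr rfl fun i _ => by ring
    have hgeom : ∑ i ∈ Finset.range K, θ ^ i ≤ 1 / (1 - θ) := by
      have h := geom_sum_Ico_le_of_lt_one (m := 0) (n := K) hθ0 hθ1
      rwa [← Finset.range_eq_Ico, pow_zero] at h
    calc ∑ y, (tdistT (fine N M) x y / (N : ℝ)) ^ ε * S₁ y
        = ∑ y, ∑ i ∈ Finset.range K, ((L : ℝ) ^ (d + 1) / (L : ℝ) ^ 2 * L * L) ^ i
          * ((tdistT (fine N M) x y / (N : ℝ)) ^ ε * Real.exp (-(δ₁ * (tdistT (fine N M) x y * (L : ℝ) ^ i / (N : ℝ))))) :=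
          Finset.sum_congr rfl fun y _ => hexpand y
      _ = ∑ i ∈ Finset.range K, ∑ y, ((L : ℝ) ^ (d + 1) / (L : ℝ) ^ 2 * L * L) ^ i
          * ((tdistT (fine N M) x y / (N : ℝ)) ^ ε * Real.exp (-(δ₁ * (tdistT (fine N M) x y * (L : ℝ) ^ i / (N : ℝ))))) :=
          Finset.sum_comm
      _ = ∑ i ∈ Finset.range K, ((L : ℝ) ^ (d + 1) / (L : ℝ) ^ 2 * L * L) ^ i
          * ∑ y, (tdistT (fine N M) x y / (N : ℝ)) ^ ε * Real.exp (-(δ₁ * (tdistT (fine N M) x y * (L : ℝ) ^ i / (N : ℝ)))) :=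
          Finset.sum_congr rfl fun i _ => by rw [Finset.mul_sum]
      _ ≤ ∑ i ∈ Finset.range K, A₁ * (N : ℝ) ^ (d + 1) * θ ^ i := Finset.sum_le_sum hlevel
      _ = A₁ * (N : ℝ) ^ (d + 1) * ∑ i ∈ Finset.range K, θ ^ i := by rw [Finset.mul_sum]
      _ ≤ A₁ * (N : ℝ) ^ (d + 1) * (1 / (1 - θ)) := mul_le_mul_of_nonneg_left hgeom (by positivity)
  -- assemble
  calc |∑ y, c * DDk y * (lam y - lam x)| ≤ ∑ y, |c * DDk y * (lam y - lam x)| := Finset.abs_sum_le_sum_abs _ _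
    _ ≤ ∑ y, c * C₀ * H * Real.exp (-(δ₀ * D₀)) * ((tdistT (fine N M) x y / (N : ℝ)) ^ ε * S₁ y) :=
        Finset.sum_le_sum fun y _ => hterm y
    _ = c * C₀ * H * Real.exp (-(δ₀ * D₀)) * ∑ y, (tdistT (fine N M) x y / (N : ℝ)) ^ ε * S₁ y := by rw [Finset.mul_sum]
    _ ≤ c * C₀ * H * Real.exp (-(δ₀ * D₀)) * (A₁ * (N : ℝ) ^ (d + 1) * (1 / (1 - θ))) :=
        mul_le_mul_of_nonneg_left hΦsum (by positivity)
    _ = (c * (N : ℝ) ^ (d + 1)) * (C₀ * A₁ / (1 - θ)) * H * Real.exp (-(δ₀ * D₀)) := by ring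
    _ = C₀ * A₁ / (1 - θ) * H * Real.exp (-(δ₀ * D₀)) := by rw [hcN, one_mul]

end Summit.QuantumFields.YangMills.BalabanUVNodes.N15KingModelRung.Curved
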